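import Summits.Ventures.PercRepro.RankLevelSetFrameLarge

/-!
# PercRepro — S1 FIXED-RANK FRAME: the unbounded-corank reduction at ONE rank `p` (p2, gen 15; SUBCLAIM-S1 §2, L-GAP-0)

`proofs/SUBCLAIM-S1-p2.md` §2, the reduction (R): night-1's wrapper `ThmN.rls_succ_large q D P`
(`RankLevelSetFrameLarge`) is a strong induction on `|E|` at a FIXED rank `p`; it calls `hprev` only at rank `p − 1`
(the contraction step) and `hsmall` / `hcore` only at the same `p`. Read at one rank, the same proof gives:

* **`rls_succ_fixed`** — level `q + 1` at the single rank `p ≥ q + 3` from level `q` at rank `p − 1` (`hprev`), level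
  `q + 1` at corank `≤ D` (`hsmall`) and the `e`-free core at rank `p`, corank `> D` (`hcore`) — no threshold on `p`,
  no other rank involved. The proof is `rls_succ_large`'s, specialised (the loop step and the deletion step keep `p`;
  the contraction step lowers it to `p − 1`; rank `< p` is empty; rank `> p` is truncated to `p`).

With the core of rank `25` closed at every corank (`S1Tail25.c025_core_four_twentyfive`), this gives level `4` at
`p = 25` (`S1LevelFourC`) — one rank below what `rls_succ_large 3 4 25` can reach (it needs the core at EVERY `p ≥ 25`
and yields `p ≥ 26`).
Axioms: standard.
-/

open scoped Matroid

namespace PercRepro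

namespace S1

variable {α : Type}

/-- **The unbounded-corank reduction at a single rank `p`** (the text of `ThmN.rls_succ_large` read at one `p`):
from level `q` at rank `p − 1` for all matroids (`hprev`), level `q + 1` at rank `p` and `|E| ≤ p + D` (`hsmall`),
and the core at rank `p`, corank `> D`, every element with an `e`-free partition (`hcore`), level `q + 1` at rank `p`
for all matroids. -/
theorem rls_succ_fixed (q D p : ℕ) (hp : q + 3 ≤ p)
    (hprev : ∀ (M : Matroid α) [M.Finite], ThmN.RLS M (p - 1) q)
    (hsmall : ∀ (M : Matroid α) [M.Finite], M.E.ncard ≤ p + D → ThmN.RLS M p (q + 1))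
    (hcore : ∀ (M : Matroid α) [M.Finite], M.eRank = (p : ℕ∞) → p + D < M.E.ncard →
      (∀ e ∈ M.E, ∃ A ⊆ M.E \ {e}, e ∉ M.closure A ∧ e ∉ M.closure ((M.E \ {e}) \ A)) →
      ThmN.RLS M p (q + 1)) :
    ∀ (M : Matroid α) [M.Finite], ThmN.RLS M p (q + 1) := by
  obtain ⟨p', rfl⟩ : ∃ p', p = p' + 1 := ⟨p - 1, by omega⟩
  have hprev' : ∀ (M : Matroid α) [M.Finite], ThmN.RLS M p' q := fun M _ => by
    simpa using hprev M
  suffices H : ∀ n : ℕ, ∀ (M : Matroid α) [M.Finite], M.E.ncard = n → ThmN.RLS M (p' + 1) (q + 1) from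
    fun M _ => H _ M rfl
  intro n
  induction n using Nat.strong_induction_on with
  | _ n ih =>
  intro M _ hn
  classical
  -- Case 0: bounded corank
  by_cases hD : n ≤ p' + 1 + D
  · exact hsmall M (by omega)
  push Not at hD
  have hdel : ∀ e ∈ M.E, (M ＼ {e}).E.ncard < n := by
    intro e he
    rw [_root_.Matroid.delete_ground, ← hn, ← Set.ncard_sdiff_singleton_add_one he M.ground_finite]
    omega
  -- Case 1: a loop (same `p`, one element fewer)
  by_cases hL : ∃ e ∈ M.E, M.IsLoop e
  · obtain ⟨e, he, hloopE⟩ := hL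
    exact ThmN.RLS_of_loop_q M hloopE (p' + 1) (q + 1) (ih _ (hdel e he) (M ＼ {e}) rfl)
  push Not at hL
  -- Case 2: loopless, rank `p` — an element without an `e`-free partition closes the step; otherwise the core.
  have hrank : ∀ (N : Matroid α) [N.Finite], N.E = M.E → N.eRank = ((p' + 1 : ℕ) : ℕ∞) →
      (∀ e ∈ N.E, N.Indep {e}) → ThmN.RLS N (p' + 1) (q + 1) := by
    intro N _ hNE hNR hNI
    by_cases hU : ∃ e ∈ N.E, ∀ A ⊆ N.E \ {e}, e ∈ N.closure A ∨ e ∈ N.closure ((N.E \ {e}) \ A)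
    · obtain ⟨e, he, hunsp⟩ := hU
      have hdelN : (N ＼ {e}).E.ncard < n := by
        rw [_root_.Matroid.delete_ground, hNE, ← hn,
          ← Set.ncard_sdiff_singleton_add_one (hNE ▸ he) M.ground_finite]
        omega
      exact ThmN.RLS_of_unspanned_q N (hNI e he) hunsp (ih _ hdelN (N ＼ {e}) rfl) (hprev' (N ／ {e}))
    · push Not at hU
      refine hcore N hNR (by rw [hNE, hn]; omega) (fun e he => ?_)
      obtain ⟨A, hA, h⟩ := hU e he
      exact ⟨A, hA, h.1, h.2⟩
  have hMI : ∀ e ∈ M.E, M.Indep {e} :=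
    fun e he => _root_.Matroid.indep_singleton.2 ((_root_.Matroid.not_isLoop_iff he).1 (hL e he))
  rcases lt_trichotomy M.eRank ((p' + 1 : ℕ) : ℕ∞) with hlt | heq | hgt
  · exact ThmN.RLS_of_eRank_lt M hlt
  · exact hrank M rfl heq hMI
  · -- `r(E) > p`: truncate to rank `p` (same ground set, same size; singletons stay independent)
    set T := Matroid.truncate M (p' + 1) with hTdef
    have hTR := ThmN.truncate_eRank_eq M hgt
    have hTE : T.E = M.E := Matroid.truncate_ground M (p' + 1)
    have hTI : ∀ e ∈ T.E, T.Indep {e} := by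
      intro e he
      have heM : e ∈ M.E := hTE ▸ he
      rw [Matroid.truncate_indep_iff]
      refine ⟨hMI e heM, ?_⟩
      rw [Set.ncard_singleton]; omega
    have hT : ThmN.RLS T (p' + 1) (q + 1) := hrank T hTE hTR hTI
    unfold ThmN.RLS at hT ⊢
    exact Matroid.rls_of_truncate M (p' + 1) (by omega) (phiK (p' + 1) (q + 1)) (by unfold phiK; positivity) hT

end S1

end PercRepro
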